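import Summits.ABC.ABC.Theses.DefiniteXi
import Literature.NumberTheory.EllipticCurves.TakahashiDegreeFormulaFromDictionary
import Literature.NumberTheory.Automorphic.BrandtEigenLine
import Summits.ABC.ABC.Theorems.DefiniteXiFreyModularity
import HarnessLib

/-!
# The Frey eigen-line at a prime quarantine of a squarefree conductor is a line
(stub `stub_freyEigenLinePrime` of line `forced-pair-dlog`, crux `EisensteinQuarantine`,
stmt-ABC-15023) — CONDITIONAL derivation from the tree's two named facts

The registered stub `stub_freyEigenLinePrime` says: for `a, b` coprime with `ab(a+b) ≠ 0`, `N` the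
(squarefree) conductor of the Frey curve `E_(a,b) = freyCurve a b`, a prime `ℓ ∣ N` and every
Brandt setup `S` of type `(N/ℓ, ℓ)`, the common eigen-lattice of the Brandt matrices `T(p)`,
`p ∤ N`, for the eigenvalues `a_p(E)` is a line `ℤ ∙ φ`, `φ ≠ 0`.

In print this is the Jacquet–Langlands correspondence / Eichler's basis problem with strong
multiplicity one for the newform of the (modular) curve `E_(a,b)`, new at `ℓ ∥ N`
(Takahashi 2001, §2 p. 78: "`L_r(J)` is a free `ℤ`-module of rank one").  The tree states exactly
this as the NAMED FACT (an unproved `def … : Prop`)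
`Literature.NumberTheory.EllipticCurves.takahashi2001_brandtEigenLattice_rank_one`
(`Module.finrank ℤ (eigenLattice (M r) …) = 1` for `W` elliptic of squarefree conductor `M r`,
`r` prime, given a `ModularParametrizationData W (M r)`), and the modularity of the Frey curve as
the route item `Summit.ABC.ABC.Theses.DefiniteXi.FreyModularity` (stmt-ABC-11340; its conditional
proof `freyModularity_of_nonempty_modularParametrizationData` from the named fact
`Literature.NumberTheory.EllipticCurves.ModularForms.nonempty_modularParametrizationData` is landed
in `Summits/ABC/ABC/Theorems/DefiniteXiFreyModularity.lean`).  Neither named fact is discharged in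
the tree, so the stub cannot land unconditionally; this file proves, sorry-free, the implication

  `takahashi2001_brandtEigenLattice_rank_one → FreyModularity → stub_freyEigenLinePrime`

(`freyEigenLinePrime_of_rankOne_of_freyModularity`), and its variant on the residual trust base
`takahashi2001_brandtEigenLattice_rank_one ∧ nonempty_modularParametrizationData`
(`freyEigenLinePrime_of_rankOne_of_nonempty_modularParametrizationData`).

Proof.  Write `N = (N/ℓ) · ℓ` (`Nat.div_mul_cancel`); `E_(a,b)` is elliptic (`isElliptic_freyCurve`);
`FreyModularity` at the level `(N/ℓ) · ℓ` gives a datum `D : ModularParametrizationData E ((N/ℓ) ℓ)`;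
the rank-one fact at `(W, M, r) := (E, N/ℓ, ℓ)` gives `finrank ℤ L = 1` for the eigen-lattice `L`;
and a rank-one `ℤ`-submodule of `ℤ^ι` (`ι` finite) is a line `ℤ ∙ φ`, `φ ≠ 0`
(`exists_eq_span_singleton_of_finrank_eq_one`: submodules of `ℤ^ι` are free of finite rank,
Mathlib `Submodule.nonempty_basis_of_pid`, and `Module.finrank_eq_card_basis` forces the basis to
have one element).
-/

-- `Summit.<Summit>.<Problem>`: for the single-conjunct summit `ABC` the duplicate `ABC.ABC` is mandated.
set_option linter.dupNamespace false

noncomputable section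

namespace Summit.ABC.ABC.Theorems

open scoped BigOperators
open Literature.NumberTheory.Automorphic Literature.NumberTheory.EllipticCurves
open Literature.NumberTheory.EllipticCurves.ModularForms

/-- **A rank-one sublattice of `ℤ^ι` is a line.**  A `ℤ`-submodule `L ⊆ ℤ^ι` (`ι` finite) with
`Module.finrank ℤ L = 1` is `ℤ ∙ φ` for some `φ ≠ 0`: `L` is free of finite rank `n` (`ℤ` is a
PID, `Submodule.nonempty_basis_of_pid`), `n = finrank ℤ L = 1` (`Module.finrank_eq_card_basis`),
and `L` is spanned by the unique basis vector. [folklore] -/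
theorem exists_eq_span_singleton_of_finrank_eq_one {ι : Type*} [Finite ι]
    (L : Submodule ℤ (ι → ℤ)) (h : Module.finrank ℤ L = 1) :
    ∃ φ : ι → ℤ, φ ≠ 0 ∧ L = ℤ ∙ φ := by
  -- adapted from `Literature.NumberTheory.Automorphic.exists_eq_span_singleton_of_ne_bot`
  obtain ⟨n, ⟨b⟩⟩ := Submodule.nonempty_basis_of_pid (Pi.basisFun ℤ ι) L
  have hn : n = 1 := by
    rw [Module.finrank_eq_card_basis b, Fintype.card_fin] at h
    exact h
  subst hn
  refine ⟨(b 0 : ι → ℤ), fun h0 => b.ne_zero 0 (Subtype.ext h0), le_antisymm ?_ ?_⟩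
  · intro x hx
    have hsum := b.sum_repr ⟨x, hx⟩
    rw [Fin.sum_univ_one] at hsum
    have hx' : x = (b.repr ⟨x, hx⟩ 0) • (b 0 : ι → ℤ) := by
      have := congrArg Subtype.val hsum
      simpa using this.symm
    rw [hx']
    exact Submodule.smul_mem _ _ (Submodule.mem_span_singleton_self _)
  · rw [Submodule.span_le, Set.singleton_subset_iff]
    exact (b 0).2

/-- **The Frey eigen-line at a prime of a squarefree conductor is a line — from multiplicity one
and modularity** (conditional form of stub `stub_freyEigenLinePrime`).  Assume Takahashi's
multiplicity one on the quaternion side (`takahashi2001_brandtEigenLattice_rank_one`: for `W`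
modular elliptic of squarefree conductor `M r`, `r` prime, the `a(W)`-eigen-lattice of the Brandt
matrices of type `(M, r)` has `ℤ`-rank one; Jacquet–Langlands / Eichler + strong multiplicity one)
and the modularity of Frey curves in datum form (`FreyModularity`).  Then for `a, b` coprime with
`ab(a+b) ≠ 0`, `N` the squarefree conductor of `E_(a,b)`, a prime `ℓ ∣ N` and every Brandt setup
`S` of type `(N/ℓ, ℓ)`, the eigen-lattice `{v : T(p) v = a_p(E) v, p ∤ N}` is `ℤ ∙ φ` with `φ ≠ 0`:
apply the fact at `(W, M, r) := (E_(a,b), N/ℓ, ℓ)` (`N = (N/ℓ) ℓ`, the datum from `FreyModularity`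
at that level) and `exists_eq_span_singleton_of_finrank_eq_one`. [cite: Takahashi2001, §2 p. 78] -/
theorem freyEigenLinePrime_of_rankOne_of_freyModularity
    (h₁ : Literature.NumberTheory.EllipticCurves.takahashi2001_brandtEigenLattice_rank_one)
    (h₂ : Summit.ABC.ABC.Theses.DefiniteXi.FreyModularity) :
    ∀ a b : ℤ, IsCoprime a b → a * b * (a + b) ≠ 0 →
      ∀ (N : ℕ) [NeZero N], (freyCurve a b).conductorNorm ℤ = N → Squarefree N →
      ∀ ℓ : ℕ, ℓ.Prime → ℓ ∣ N →
      ∀ (S : Brandt.XiSetup (N / ℓ) ℓ) [Fintype (Brandt.ClassSet S.O)],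
        ∃ φ : Brandt.ClassSet S.O → ℤ, φ ≠ 0 ∧
          Brandt.eigenLattice (N / ℓ * ℓ) (Brandt.matrix S.O)
            (fun n => (freyCurve a b).LFunction n) = ℤ ∙ φ := by
  intro a b hab h0 N _ hN hsq ℓ hℓ hℓN S _
  haveI : (freyCurve a b).IsElliptic := isElliptic_freyCurve h0
  -- `N = (N/ℓ) · ℓ`
  have hNeq : N / ℓ * ℓ = N := Nat.div_mul_cancel hℓN
  haveI : NeZero (N / ℓ * ℓ) := ⟨by rw [hNeq]; exact NeZero.ne N⟩
  have hsq' : Squarefree (N / ℓ * ℓ) := by rw [hNeq]; exact hsq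
  have hN' : (freyCurve a b).conductorNorm ℤ = N / ℓ * ℓ := hN.trans hNeq.symm
  -- modularity: a parametrisation datum at level `(N/ℓ) · ℓ`
  obtain ⟨D⟩ := h₂ a b hab h0 (N / ℓ * ℓ) hN'
  -- multiplicity one: the eigen-lattice has rank one, hence is a line
  exact exists_eq_span_singleton_of_finrank_eq_one _ (h₁ (freyCurve a b) (N / ℓ) ℓ hℓ hsq' hN' D S)

/-- **The same on the residual trust base of the tree** (the two undischarged Literature facts the
stub ultimately rests on): Takahashi's multiplicity one
(`takahashi2001_brandtEigenLattice_rank_one`) and the Modularity Theorem in datum form for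
globally minimal models (`nonempty_modularParametrizationData`, Wiles 1995 /
Breuil–Conrad–Diamond–Taylor 2001 Thm. A), the latter giving `FreyModularity` by the landed
transport `freyModularity_of_nonempty_modularParametrizationData`. [cite: Takahashi2001, §2 p. 78] -/
theorem freyEigenLinePrime_of_rankOne_of_nonempty_modularParametrizationData
    (h₁ : Literature.NumberTheory.EllipticCurves.takahashi2001_brandtEigenLattice_rank_one)
    (h₂ : nonempty_modularParametrizationData) :
    ∀ a b : ℤ, IsCoprime a b → a * b * (a + b) ≠ 0 →
      ∀ (N : ℕ) [NeZero N], (freyCurve a b).conductorNorm ℤ = N → Squarefree N →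
      ∀ ℓ : ℕ, ℓ.Prime → ℓ ∣ N →
      ∀ (S : Brandt.XiSetup (N / ℓ) ℓ) [Fintype (Brandt.ClassSet S.O)],
        ∃ φ : Brandt.ClassSet S.O → ℤ, φ ≠ 0 ∧
          Brandt.eigenLattice (N / ℓ * ℓ) (Brandt.matrix S.O)
            (fun n => (freyCurve a b).LFunction n) = ℤ ∙ φ :=
  freyEigenLinePrime_of_rankOne_of_freyModularity h₁
    (freyModularity_of_nonempty_modularParametrizationData h₂)

/-- **Uncurried form, ready to register as a sub-goal of stmt-ABC-15023** (`--supports` files must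
prove a registered stub by name and verbatim uncurried signature; the curried
`freyEigenLinePrime_of_rankOne_of_freyModularity` is the working corollary):
`takahashi2001_brandtEigenLattice_rank_one → FreyModularity → stub_freyEigenLinePrime`.
[cite: Takahashi2001, §2 p. 78] -/
theorem stub_freyEigenLinePrime_of_rankOne_of_freyModularity :
    Literature.NumberTheory.EllipticCurves.takahashi2001_brandtEigenLattice_rank_one →
    Summit.ABC.ABC.Theses.DefiniteXi.FreyModularity →
    ∀ a b : ℤ, IsCoprime a b → a * b * (a + b) ≠ 0 →
      ∀ (N : ℕ) [NeZero N], (freyCurve a b).conductorNorm ℤ = N → Squarefree N →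
      ∀ ℓ : ℕ, ℓ.Prime → ℓ ∣ N →
      ∀ (S : Brandt.XiSetup (N / ℓ) ℓ) [Fintype (Brandt.ClassSet S.O)],
        ∃ φ : Brandt.ClassSet S.O → ℤ, φ ≠ 0 ∧
          Brandt.eigenLattice (N / ℓ * ℓ) (Brandt.matrix S.O)
            (fun n => (freyCurve a b).LFunction n) = ℤ ∙ φ :=
  fun h₁ h₂ => freyEigenLinePrime_of_rankOne_of_freyModularity h₁ h₂

/-! ## Re-wiring through the route item `BrandtEigenLatticeRankOne` (stmt-ABC-17203)

Since the route-choice repair b6fe27e7 (2026-08-17) the multiplicity-one debt is the route ITEM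
`Summit.ABC.ABC.Theses.DefiniteXi.BrandtEigenLatticeRankOne` (crux r8), whose body is VERBATIM the named
fact `takahashi2001_brandtEigenLattice_rank_one`.  The two theorems below record the definitional
equivalence and re-state the eigen-line glue with the ITEM as hypothesis, so that the line skeleton
`Cruxes/EisensteinQuarantine/Lines/forced_pair_dlog.lean` (rev 4: stubs `stub_brandtEigenLatticeRankOne`,
`stub_freyModularity`) and the conditional refutations `Theorems/EisensteinQuarantine/Negative/*` can
display route items only (lead c5 of stmt-ABC-15023). -/

/-- **The route item `BrandtEigenLatticeRankOne` (stmt-ABC-17203) IS Takahashi's multiplicity-one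
fact**, definitionally: both are the same closed statement (`Module.finrank ℤ (eigenLattice …) = 1`
for `W` elliptic of squarefree conductor `M r`, `r` prime, with a parametrisation datum at level
`M r`, in every Brandt setup of type `(M, r)`). [cite: Takahashi2001, §2 p. 78] -/
theorem brandtEigenLatticeRankOne_iff_takahashi2001 :
    Summit.ABC.ABC.Theses.DefiniteXi.BrandtEigenLatticeRankOne ↔
      Literature.NumberTheory.EllipticCurves.takahashi2001_brandtEigenLattice_rank_one :=
  Iff.rfl

/-- **The Frey eigen-line at a prime of a squarefree conductor is a line — from the two ROUTE ITEMS
`BrandtEigenLatticeRankOne` (stmt-ABC-17203) and `FreyModularity` (stmt-ABC-11340).**  For `a, b`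
coprime with `ab(a+b) ≠ 0`, `N` the squarefree conductor of `E_(a,b)`, a prime `ℓ ∣ N` and every
Brandt setup `S` of type `(N/ℓ, ℓ)`, the `a(E)`-eigen-lattice of the Brandt matrices is `ℤ ∙ φ`,
`φ ≠ 0`.  This is `freyEigenLinePrime_of_rankOne_of_freyModularity` read through the definitional
equality `brandtEigenLatticeRankOne_iff_takahashi2001`; it is the proof term of the rev-4 skeleton glue
`freyEigenLinePrime_of_items`. [cite: Takahashi2001, §2 p. 78] -/
theorem freyEigenLinePrime_of_brandtEigenLatticeRankOne_of_freyModularity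
    (h₁ : Summit.ABC.ABC.Theses.DefiniteXi.BrandtEigenLatticeRankOne)
    (h₂ : Summit.ABC.ABC.Theses.DefiniteXi.FreyModularity) :
    ∀ a b : ℤ, IsCoprime a b → a * b * (a + b) ≠ 0 →
      ∀ (N : ℕ) [NeZero N], (freyCurve a b).conductorNorm ℤ = N → Squarefree N →
      ∀ ℓ : ℕ, ℓ.Prime → ℓ ∣ N →
      ∀ (S : Brandt.XiSetup (N / ℓ) ℓ) [Fintype (Brandt.ClassSet S.O)],
        ∃ φ : Brandt.ClassSet S.O → ℤ, φ ≠ 0 ∧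
          Brandt.eigenLattice (N / ℓ * ℓ) (Brandt.matrix S.O)
            (fun n => (freyCurve a b).LFunction n) = ℤ ∙ φ :=
  freyEigenLinePrime_of_rankOne_of_freyModularity
    (brandtEigenLatticeRankOne_iff_takahashi2001.mp h₁) h₂

/-- **Uncurried form, registered as a sub-goal of stmt-ABC-15023** (rev-4 skeleton glue
`freyEigenLinePrime_of_items` with its two item-stubs displayed):
`BrandtEigenLatticeRankOne → FreyModularity → (eigen-line at a prime of a squarefree conductor)`.
[cite: Takahashi2001, §2 p. 78] -/
theorem stub_freyEigenLinePrime_of_items :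
    Summit.ABC.ABC.Theses.DefiniteXi.BrandtEigenLatticeRankOne →
    Summit.ABC.ABC.Theses.DefiniteXi.FreyModularity →
    ∀ a b : ℤ, IsCoprime a b → a * b * (a + b) ≠ 0 →
      ∀ (N : ℕ) [NeZero N], (freyCurve a b).conductorNorm ℤ = N → Squarefree N →
      ∀ ℓ : ℕ, ℓ.Prime → ℓ ∣ N →
      ∀ (S : Brandt.XiSetup (N / ℓ) ℓ) [Fintype (Brandt.ClassSet S.O)],
        ∃ φ : Brandt.ClassSet S.O → ℤ, φ ≠ 0 ∧
          Brandt.eigenLattice (N / ℓ * ℓ) (Brandt.matrix S.O)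
            (fun n => (freyCurve a b).LFunction n) = ℤ ∙ φ :=
  fun h₁ h₂ => freyEigenLinePrime_of_brandtEigenLatticeRankOne_of_freyModularity h₁ h₂

end Summit.ABC.ABC.Theorems

end
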